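import Summits.BirchSwinnertonDyer.Rank1Residual.X11b.BDPValueRigidityInt
import HarnessLib

/-!
# Class X11b, every prime `p`: ONE-SIDED ♭-V1RIG — a Λ-adic frame `Q' ∈ 𝓞_{ℂ_p}⟦T⟧` against a
# family of VALUES converging to `c ≠ 0` (the kernel core of "a value theorem for a CONTINUOUS
# FUNCTION on characters transfers to any BDP frame"; cell `b2b-bsdres`, sub-cell `multr1-p2`, gen 25)

HONEST FRAMING (cell `b2b-bsdres`, run/shared/lean/b2b/bsd-rank1-residual/, verbatim in every
file): the goal of the cell is to DELETE the COMBINATION-SHAPED residual classes of the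
Birch–Swinnerton-Dyer formula for ALL analytic-rank `≤ 1` elliptic curves over `ℚ` — "full BSD
formula for every rank `≤ 1` curve in class `C`" assembled STRICTLY from published theorems — so
that the rank-`≤ 1` remainder becomes exactly the CONSTRUCTION-SHAPED classes, which are TYPED
(missing-input `Prop`s), NOT attempted. This is not "finishing BSD". Sub-cell `multr1-p2` is a
RESEARCH ROUTE on class X11b (`ClassX11b W p := r_an = 1 ∧ p ≠ 2 ∧ mult(p) ∧ irr(p)`); no claim
beyond the stated class and loci; X11b's label does not change; NOTHING is booked by this file.

THEOREMS ONLY (elementary `p`-adic analysis; no definition, no named fact, no `sorry`). CREDIT: the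
argument is x11b3-p3's S27 'V1RIG' core (`Halves.constantCoeff_eq_of_values_mul_sq_of_ne_zero`,
p263231) with the first frame replaced by an abstract pair of convergent value sequences; the ♭ port
of the two-frame form is `IntSeriesValueRigidity.lean` (gen 25).

## Why (route p2, trigger (b) of REPORT §30.6 / §31)

On the 769 432 non-semistable SPLIT X11b pairs the BDP value at `𝟙` is printed ([cas-split] = Castella,
JIMJ 2018, Thms. 2.10–2.11, split `p ≥ 5`, any tame level) for an object typed as a CONTINUOUS
FUNCTION on characters — values `v(χ)` with the squared-BDP interpolation at the `χ` of type `(n,−n)`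
and `v(𝟙)` = the BDP value — not as a Λ-adic element. To read such a theorem into route p2's value
shape `P2.BDPValueSomeFrameOnTree` (a statement about the constant term of a ♭-frame `Q'`) one needs:
(i) interpolation characters accumulating at `𝟙` (gen 25: `exists_interpolationSupply_pow`, a
THEOREM), (ii) continuity of the function at `𝟙` along them (the source), and (iii) THIS FILE: if the
frame `Q'` takes at the supply's points the values `a_k·v_k`, `a_k²·w_k` with `v_k, w_k → c ≠ 0`
(`a_k = β^{m p^k}` the period-ratio factor), then `[T⁰]Q' = c`. No Λ-adic structure is asked of the
`v`-side. (The case `c = 0` is not covered one-sidedly; at p2 data `c = u·((1 − a_p p⁻¹) log_ω P')²`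
with `P'` non-torsion, so `c ≠ 0` is the relevant case.)

## What this file proves

* **`intSeries_constantCoeff_eq_of_tendsto_of_values_mul_sq`**: `T_k → 0`, `a_k ≠ 0`, `v_k → c`,
  `w_k → c`, `c ≠ 0`, `Q'(T_k) = a_k v_k`, `Q'(T_k(T_k+2)) = a_k² w_k` ⟹ `[T⁰]Q' = c`.
* **`intSeries_constantCoeff_eq_of_isBDPLFunctionInt_of_tendsto`**: the BDP form — a ♭-frame
  `(Ω_K', Ω_p', Q')` and "virtual periods" `(Ω_K, Ω_p)` (non-zero) whose would-be interpolation values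
  along the two families `φ^{p^k}`, `φ^{2p^k}` of a character supply converge to `c ≠ 0` ⟹ `[T⁰]Q' = c`;
  **`…_of_isAnticyclotomic`**: the same with the supply DISCHARGED (odd `p`, `K` imaginary quadratic,
  `κ` anticyclotomic, `κ.IsTopGenerator γ`) — stated with the supply's data exposed so that a
  continuity hypothesis can be phrased on it.

## References

* [Castella2018] Thms. 3.1–3.2 (arXiv:1704.06608 pp. 8–9). * [CastellaHsieh2018] §3.3.
* [Cassels1986] Ch. 4 Lemma 2.1.
-/

noncomputable section

open scoped Classical Topology NumberField
open Filter NumberField IsDedekindDomain Field PowerSeries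
  Literature.NumberTheory.EllipticCurves Literature.NumberTheory.GaloisRepresentations

namespace Summit.BirchSwinnertonDyer.Rank1Residual.X11b

open Summit.BirchSwinnertonDyer.Rank1Residual.X11b.Halves

variable {p : ℕ} [Fact p.Prime]

/-! ### §1 The one-sided abstract core -/

/-- **One-sided ♭-V1RIG core.** Along `T_k → 0` let `Q' ∈ 𝓞_{ℂ_p}⟦T⟧` take the values `a_k·v_k` at
`T_k` and `a_k²·w_k` at `T_k(T_k + 2)`, with `a_k ≠ 0` and `v_k, w_k → c ≠ 0` (ANY sequences — no
power series on the `v`-side). Then `[T⁰]Q' = c`: `a_k → ρ = c'/c` and `a_k² → ρ`, so `ρ ∈ {0,1}`;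
`ρ = 0` contradicts the ORDER LEMMA for `Q'` (`‖a_k‖ = ‖2‖^d` for large `k`); so `c' = c`.
(x11b3-p3's argument; `v`-side abstracted.) [folklore] -/
theorem intSeries_constantCoeff_eq_of_tendsto_of_values_mul_sq {Q' : PowerSeries 𝓞_ℂ_[p]}
    {T v w a : ℕ → ℂ_[p]} {c : ℂ_[p]} (hT0 : Tendsto T atTop (𝓝 0)) (ha : ∀ k, a k ≠ 0)
    (hv_lim : Tendsto v atTop (𝓝 c)) (hw_lim : Tendsto w atTop (𝓝 c)) (hc0 : c ≠ 0)
    (hv' : ∀ k, IntSeries.HasValueAt Q' (T k) (a k * v k))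
    (hw' : ∀ k, IntSeries.HasValueAt Q' (T k * (T k + 2)) (a k ^ 2 * w k)) :
    ((constantCoeff Q' : 𝓞_ℂ_[p]) : ℂ_[p]) = c := by
  set c' : ℂ_[p] := ((constantCoeff Q' : 𝓞_ℂ_[p]) : ℂ_[p]) with hc'def
  have hT2 : Tendsto (fun k ↦ T k + 2) atTop (𝓝 2) := by simpa using hT0.add_const 2
  have hT'0 : Tendsto (fun k ↦ T k * (T k + 2)) atTop (𝓝 0) := by simpa using hT0.mul hT2
  -- (i) the limits of the frame's values
  have hav_lim : Tendsto (fun k ↦ a k * v k) atTop (𝓝 c') :=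
    intSeries_tendsto_value_of_tendsto_zero hT0 hv'
  have haw_lim : Tendsto (fun k ↦ a k ^ 2 * w k) atTop (𝓝 c') :=
    intSeries_tendsto_value_of_tendsto_zero hT'0 hw'
  have hvne : ∀ᶠ k in atTop, v k ≠ 0 := by
    filter_upwards [eventually_norm_eq_of_tendsto hc0 hv_lim] with k hk
    rw [← norm_ne_zero_iff, hk, norm_ne_zero_iff]
    exact hc0
  have hwne : ∀ᶠ k in atTop, w k ≠ 0 := by
    filter_upwards [eventually_norm_eq_of_tendsto hc0 hw_lim] with k hk
    rw [← norm_ne_zero_iff, hk, norm_ne_zero_iff]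
    exact hc0
  -- (ii) `a_k → ρ` and `a_k² → ρ`
  set ρ : ℂ_[p] := c' / c with hρdef
  have ha_lim : Tendsto a atTop (𝓝 ρ) := by
    refine (hav_lim.div hv_lim hc0).congr' ?_
    filter_upwards [hvne] with k hk
    simp only [Pi.div_apply]
    exact mul_div_cancel_right₀ (a k) hk
  have ha2_lim : Tendsto (fun k ↦ a k ^ 2) atTop (𝓝 ρ) := by
    refine (haw_lim.div hw_lim hc0).congr' ?_
    filter_upwards [hwne] with k hk
    simp only [Pi.div_apply]
    exact mul_div_cancel_right₀ (a k ^ 2) hk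
  have hρsq : ρ ^ 2 = ρ := tendsto_nhds_unique (ha_lim.pow 2) ha2_lim
  have hc'ρ : c' = ρ * c := by rw [hρdef, div_mul_cancel₀ _ hc0]
  have hρ01 : ρ = 0 ∨ ρ = 1 := by
    have h : ρ * (ρ - 1) = 0 := by rw [mul_sub, mul_one, ← sq, hρsq, sub_self]
    rcases mul_eq_zero.mp h with h | h
    · exact Or.inl h
    · exact Or.inr (sub_eq_zero.mp h)
  rcases hρ01 with hρ0 | hρ1
  · -- (ii') `ρ = 0` is impossible
    exfalso
    have ha0 : Tendsto a atTop (𝓝 0) := hρ0 ▸ ha_lim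
    obtain ⟨K, hK⟩ := hvne.exists
    have hQ'ne : Q' ≠ 0 := by
      intro h0
      have h00 := intSeries_hasValueAt_zero_series (p := p) (T K)
      rw [← h0] at h00
      exact mul_ne_zero (ha K) hK ((hv' K).unique h00)
    set d : ℕ := Q'.order.toNat with hddef
    set g₀ : ℂ_[p] := ((coeff d Q' : 𝓞_ℂ_[p]) : ℂ_[p]) with hg₀def
    have hg₀ : g₀ ≠ 0 := by
      rw [hg₀def, Ne, ZeroMemClass.coe_eq_zero, hddef]
      exact coeff_order hQ'ne
    have hg₀pos : 0 < ‖g₀‖ := norm_pos_iff.mpr hg₀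
    have h2pos : 0 < ‖(2 : ℂ_[p])‖ := norm_pos_iff.mpr two_ne_zero
    have h2d : 0 < ‖(2 : ℂ_[p])‖ ^ d := pow_pos h2pos d
    have hTn : Tendsto (fun k ↦ ‖T k‖) atTop (𝓝 0) := tendsto_zero_iff_norm_tendsto_zero.mp hT0
    have hT'n : Tendsto (fun k ↦ ‖T k * (T k + 2)‖) atTop (𝓝 0) :=
      tendsto_zero_iff_norm_tendsto_zero.mp hT'0
    have han : Tendsto (fun k ↦ ‖a k‖) atTop (𝓝 0) := tendsto_zero_iff_norm_tendsto_zero.mp ha0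
    have E1 : ∀ᶠ k in atTop, ‖T k‖ < 1 := hTn.eventually_lt_const zero_lt_one
    have E2 : ∀ᶠ k in atTop, ‖T k‖ < ‖g₀‖ := hTn.eventually_lt_const hg₀pos
    have E3 : ∀ᶠ k in atTop, ‖T k * (T k + 2)‖ < 1 := hT'n.eventually_lt_const zero_lt_one
    have E4 : ∀ᶠ k in atTop, ‖T k * (T k + 2)‖ < ‖g₀‖ := hT'n.eventually_lt_const hg₀pos
    have E5 : ∀ᶠ k in atTop, ‖v k‖ = ‖c‖ := eventually_norm_eq_of_tendsto hc0 hv_lim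
    have E6 : ∀ᶠ k in atTop, ‖w k‖ = ‖c‖ := eventually_norm_eq_of_tendsto hc0 hw_lim
    have E7 : ∀ᶠ k in atTop, ‖T k + 2‖ = ‖(2 : ℂ_[p])‖ :=
      eventually_norm_eq_of_tendsto two_ne_zero hT2
    have E8 : ∀ᶠ k in atTop, ‖a k‖ < ‖(2 : ℂ_[p])‖ ^ d := han.eventually_lt_const h2d
    obtain ⟨k, h1, h2, h3, h4, h5, h6, h7, h8⟩ :=
      (E1.and (E2.and (E3.and (E4.and (E5.and (E6.and (E7.and E8))))))).exists
    have hA : ‖a k‖ * ‖c‖ = ‖T k‖ ^ d * ‖g₀‖ := by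
      rw [← h5, ← norm_mul (a k) (v k)]
      exact intSeries_norm_value_eq_of_order h1 h2 (hv' k)
    have hB : ‖a k‖ ^ 2 * ‖c‖ = ‖T k‖ ^ d * ‖(2 : ℂ_[p])‖ ^ d * ‖g₀‖ := by
      rw [← h7, ← mul_pow, ← norm_mul (T k) (T k + 2), ← h6, ← norm_pow (a k) 2,
        ← norm_mul (a k ^ 2) (w k)]
      exact intSeries_norm_value_eq_of_order h3 h4 (hw' k)
    have hB' : ‖a k‖ ^ 2 * ‖c‖ = ‖(2 : ℂ_[p])‖ ^ d * (‖a k‖ * ‖c‖) := by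
      rw [hB, hA]; ring
    have hcpos : 0 < ‖c‖ := norm_pos_iff.mpr hc0
    have hak : ‖a k‖ = ‖(2 : ℂ_[p])‖ ^ d := by
      have hne : ‖a k‖ * ‖c‖ ≠ 0 := mul_ne_zero (norm_ne_zero_iff.mpr (ha k)) hcpos.ne'
      have : ‖a k‖ * (‖a k‖ * ‖c‖) = ‖(2 : ℂ_[p])‖ ^ d * (‖a k‖ * ‖c‖) := by rw [← hB']; ring
      exact mul_right_cancel₀ hne this
    exact (lt_irrefl _) (hak ▸ h8)
  · -- (iii) `ρ = 1`: `c' = c`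
    rw [hc'ρ, hρ1, one_mul]


/-! ### §2 The BDP form: a ♭-frame against "virtual periods" whose values converge -/

section BDP

variable {K : Type} [Field K] [NumberField K] {N : ℕ}

/-- **One-sided ♭-V1RIG at the BDP frames, with an explicit supply.** Let `(Ω_K', Ω_p', Q')` be a
♭-frame (`R1.IsBDPLFunctionInt p ι 𝔭 κ γ f Ω_K' Ω_p' Q'`) and `(Ω_K, Ω_p)` ANY non-zero "virtual
periods" (no power series attached); let `(φ^{p^k}, m p^k, r_k)`, `(φ^{2p^k}, 2 m p^k, r'_k)` be a
character supply with avatar values `x₀^{p^k} → 1`, `x₀^{2p^k}`. If the would-be interpolation values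
of the virtual frame along the two families converge to `c ≠ 0`, then `[T⁰]Q' = c`. (So a VALUE
THEOREM for any object — e.g. a continuous function on characters — that shares Castella's
interpolation display in the normalisation `(Ω_K, Ω_p)` and is continuous at `𝟙` along the supply
transfers to every Λ-adic frame.) [cite: Castella2018, Thm. 3.1–3.2 (arXiv:1704.06608 pp. 8–9)]
[cite: CastellaHsieh2018, §3.3, Def. 3.5 and Prop. 3.6] -/
theorem intSeries_constantCoeff_eq_of_isBDPLFunctionInt_of_tendsto (K : Type) [Field K] [NumberField K]
    (N : ℕ) (ι : PadicAlgCl p ≃+* ℂ) (𝔭 : HeightOneSpectrum (𝓞 K)) (κ : ZpExtension K p)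
    (γ : Field.absoluteGaloisGroup K) (f : CuspForm (CongruenceSubgroup.Gamma0 N) 2) (ΩK ΩK' : ℂ)
    (Ωp Ωp' : ℂ_[p]) (Q' : PowerSeries 𝓞_ℂ_[p]) (m : ℕ) (x₀ : ℂ_[p]) (φ φ' : ℕ → HeckeCharacter K)
    (r r' : ℕ → FramedGaloisRep K (PadicAlgCl p) 1) (c : ℂ_[p])
    (hm : 0 < m) (hx : Tendsto (fun k ↦ x₀ ^ p ^ k) atTop (𝓝 1))
    (hunr : ∀ k (v : HeightOneSpectrum (𝓞 K)), (φ k).IsUnramifiedAt v)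
    (hinf : ∀ k, (φ k).HasInfinityType (fun _ ↦ ((m * p ^ k : ℕ) : ℤ))
      (fun _ ↦ -((m * p ^ k : ℕ) : ℤ)))
    (hr : ∀ k, IsPAdicAvatarOf ι (φ k) (r k)) (hrκ : ∀ k, FactorsThroughZp κ (r k))
    (hval : ∀ k, avatarValueAt (r k) γ = x₀ ^ p ^ k)
    (hunr' : ∀ k (v : HeightOneSpectrum (𝓞 K)), (φ' k).IsUnramifiedAt v)
    (hinf' : ∀ k, (φ' k).HasInfinityType (fun _ ↦ ((2 * m * p ^ k : ℕ) : ℤ))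
      (fun _ ↦ -((2 * m * p ^ k : ℕ) : ℤ)))
    (hr' : ∀ k, IsPAdicAvatarOf ι (φ' k) (r' k)) (hrκ' : ∀ k, FactorsThroughZp κ (r' k))
    (hval' : ∀ k, avatarValueAt (r' k) γ = x₀ ^ (2 * p ^ k))
    (hΩK : ΩK ≠ 0) (hΩK' : ΩK' ≠ 0) (hΩp : Ωp ≠ 0) (hΩp' : Ωp' ≠ 0)
    (hv : Tendsto (fun k ↦ ((ι.symm (bdpInterpolationValue p f 𝔭 (φ k) (m * p ^ k) ΩK) :
      PadicAlgCl p) : ℂ_[p]) * Ωp ^ (4 * (m * p ^ k))) atTop (𝓝 c))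
    (hw : Tendsto (fun k ↦ ((ι.symm (bdpInterpolationValue p f 𝔭 (φ' k) (2 * m * p ^ k) ΩK) :
      PadicAlgCl p) : ℂ_[p]) * Ωp ^ (4 * (2 * m * p ^ k))) atTop (𝓝 c))
    (hc : c ≠ 0) (hQ' : R1.IsBDPLFunctionInt p ι 𝔭 κ γ f ΩK' Ωp' Q') :
    ((constantCoeff Q' : 𝓞_ℂ_[p]) : ℂ_[p]) = c := by
  have hp : p.Prime := Fact.out
  set T : ℕ → ℂ_[p] := fun k ↦ x₀ ^ p ^ k - 1 with hT
  have hT0 : Tendsto T atTop (𝓝 0) := by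
    have h := hx.sub_const 1
    rwa [sub_self] at h
  set β : ℂ_[p] := ((ι.symm ((ΩK / ΩK') ^ 4) : PadicAlgCl p) : ℂ_[p]) * (Ωp' / Ωp) ^ 4 with hβ
  have hβ0 : β ≠ 0 := by
    refine mul_ne_zero ?_ (pow_ne_zero _ (div_ne_zero hΩp' hΩp))
    rw [PadicComplex.coe_eq]
    exact (map_ne_zero_iff _ (algebraMap (PadicAlgCl p) ℂ_[p]).injective).mpr
      ((map_ne_zero_iff _ ι.symm.injective).mpr (pow_ne_zero _ (div_ne_zero hΩK hΩK')))
  set a : ℕ → ℂ_[p] := fun k ↦ β ^ (m * p ^ k) with ha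
  have ha0 : ∀ k, a k ≠ 0 := fun k ↦ pow_ne_zero _ hβ0
  have hn : ∀ k, 0 < m * p ^ k := fun k ↦ Nat.mul_pos hm (pow_pos hp.pos k)
  have hn' : ∀ k, 0 < 2 * m * p ^ k := fun k ↦ Nat.mul_pos (Nat.mul_pos two_pos hm) (pow_pos hp.pos k)
  have hT' : ∀ k, x₀ ^ (2 * p ^ k) - 1 = T k * (T k + 2) := by
    intro k
    simp only [hT]
    ring
  set v : ℕ → ℂ_[p] := fun k ↦
    ((ι.symm (bdpInterpolationValue p f 𝔭 (φ k) (m * p ^ k) ΩK) : PadicAlgCl p) : ℂ_[p]) *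
      Ωp ^ (4 * (m * p ^ k)) with hvdef
  set w : ℕ → ℂ_[p] := fun k ↦
    ((ι.symm (bdpInterpolationValue p f 𝔭 (φ' k) (2 * m * p ^ k) ΩK) : PadicAlgCl p) : ℂ_[p]) *
      Ωp ^ (4 * (2 * m * p ^ k)) with hwdef
  have hQ'v : ∀ k, IntSeries.HasValueAt Q' (T k) (a k * v k) := by
    intro k
    have h := intSeries_hasValueAt_frame_rescale hΩK hΩK' hΩp hQ' (hn k) (hunr k) (hinf k) (hr k)
      (hrκ k)
    have hvals : ((ι.symm (bdpInterpolationValue p f 𝔭 (φ k) (m * p ^ k) ΩK) : PadicAlgCl p) :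
        ℂ_[p]) * Ωp ^ (4 * (m * p ^ k)) *
        (((ι.symm ((ΩK / ΩK') ^ 4) : PadicAlgCl p) : ℂ_[p]) * (Ωp' / Ωp) ^ 4) ^ (m * p ^ k) =
        a k * v k := by
      simp only [ha, hvdef, hβ]
      ring
    rw [hval k, hvals] at h
    exact h
  have hQ'w : ∀ k, IntSeries.HasValueAt Q' (T k * (T k + 2)) (a k ^ 2 * w k) := by
    intro k
    have h := intSeries_hasValueAt_frame_rescale hΩK hΩK' hΩp hQ' (hn' k) (hunr' k) (hinf' k)
      (hr' k) (hrκ' k)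
    have hvals : ((ι.symm (bdpInterpolationValue p f 𝔭 (φ' k) (2 * m * p ^ k) ΩK) :
        PadicAlgCl p) : ℂ_[p]) * Ωp ^ (4 * (2 * m * p ^ k)) *
        (((ι.symm ((ΩK / ΩK') ^ 4) : PadicAlgCl p) : ℂ_[p]) * (Ωp' / Ωp) ^ 4) ^ (2 * m * p ^ k) =
        a k ^ 2 * w k := by
      simp only [ha, hwdef, hβ]
      ring
    rw [hval' k, hT' k, hvals] at h
    exact h
  exact intSeries_constantCoeff_eq_of_tendsto_of_values_mul_sq hT0 ha0 hv hw hc hQ'v hQ'w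

/-- **One-sided ♭-V1RIG WITHOUT supply hypotheses, against a CONTINUOUS value assignment.** For odd
`p`, `K` imaginary quadratic, `κ` anticyclotomic with topological generator `γ`: if the would-be
interpolation values `ι⁻¹(bdpInterpolationValue p f 𝔭 φ n Ω_K)·Ω_p^{4n}` of the virtual frame
`(Ω_K, Ω_p)` (non-zero periods) tend to `c ≠ 0` along EVERY interpolation sequence `(φ_k, n_k, r_k)`
with `r_k(γ) → 1` — the continuity at `𝟙` of a function on characters carrying Castella's display —,
then every ♭-frame `(Ω_K', Ω_p', Q')` of the same `(ι, 𝔭, κ, γ, f)` has `[T⁰]Q' = c`. The supply is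
gen 25's `exists_interpolationSupply_pow`. [cite: Castella2018, Thm. 3.1–3.2 (arXiv:1704.06608 pp. 8–9)] -/
theorem intSeries_constantCoeff_eq_of_isBDPLFunctionInt_of_continuousValues (hp2 : p ≠ 2)
    {ι : PadicAlgCl p ≃+* ℂ} {𝔭 : HeightOneSpectrum (𝓞 K)} {κ : ZpExtension K p}
    {γ : Field.absoluteGaloisGroup K} {f : CuspForm (CongruenceSubgroup.Gamma0 N) 2}
    {ΩK ΩK' : ℂ} {Ωp Ωp' : ℂ_[p]} {Q' : PowerSeries 𝓞_ℂ_[p]} {c : ℂ_[p]}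
    (hK : IsImaginaryQuadratic K) (hκ : κ.IsAnticyclotomic) (hγ : κ.IsTopGenerator γ)
    (hΩK : ΩK ≠ 0) (hΩK' : ΩK' ≠ 0) (hΩp : Ωp ≠ 0) (hΩp' : Ωp' ≠ 0)
    (hcont : ∀ (φ : ℕ → HeckeCharacter K) (n : ℕ → ℕ) (r : ℕ → FramedGaloisRep K (PadicAlgCl p) 1),
      (∀ k, 0 < n k) → (∀ k (v : HeightOneSpectrum (𝓞 K)), (φ k).IsUnramifiedAt v) →
      (∀ k, (φ k).HasInfinityType (fun _ ↦ (n k : ℤ)) (fun _ ↦ -(n k : ℤ))) →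
      (∀ k, IsPAdicAvatarOf ι (φ k) (r k)) → (∀ k, FactorsThroughZp κ (r k)) →
      Tendsto (fun k ↦ avatarValueAt (r k) γ) atTop (𝓝 1) →
      Tendsto (fun k ↦ ((ι.symm (bdpInterpolationValue p f 𝔭 (φ k) (n k) ΩK) : PadicAlgCl p) :
        ℂ_[p]) * Ωp ^ (4 * n k)) atTop (𝓝 c))
    (hc : c ≠ 0) (hQ' : R1.IsBDPLFunctionInt p ι 𝔭 κ γ f ΩK' Ωp' Q') :
    ((constantCoeff Q' : 𝓞_ℂ_[p]) : ℂ_[p]) = c := by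
  have hp : p.Prime := Fact.out
  obtain ⟨m, x₀, φ, φ', r, r', hm, -, hx, hunr, hinf, hr, hrκ, hval, hunr', hinf', hr', hrκ', hval'⟩ :=
    exists_interpolationSupply_pow hp2 ι K κ hK hκ γ hγ
  have hn : ∀ k, 0 < m * p ^ k := fun k ↦ Nat.mul_pos hm (pow_pos hp.pos k)
  have hn' : ∀ k, 0 < 2 * m * p ^ k := fun k ↦ Nat.mul_pos (Nat.mul_pos two_pos hm) (pow_pos hp.pos k)
  have hlim : Tendsto (fun k ↦ avatarValueAt (r k) γ) atTop (𝓝 1) := by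
    simp_rw [hval]; exact hx
  have hlim' : Tendsto (fun k ↦ avatarValueAt (r' k) γ) atTop (𝓝 1) := by
    simp_rw [hval']
    have h2 : Tendsto (fun k ↦ (x₀ ^ p ^ k) ^ 2) atTop (𝓝 1) := by simpa using hx.pow 2
    refine h2.congr fun k ↦ ?_
    ring
  have hv := hcont (fun k ↦ φ k) (fun k ↦ m * p ^ k) r hn hunr hinf hr hrκ hlim
  have hw := hcont (fun k ↦ φ' k) (fun k ↦ 2 * m * p ^ k) r' hn' hunr' hinf' hr' hrκ' hlim'
  exact intSeries_constantCoeff_eq_of_isBDPLFunctionInt_of_tendsto K N ι 𝔭 κ γ f ΩK ΩK' Ωp Ωp' Q' m x₀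
    φ φ' r r' c hm hx hunr hinf hr hrκ hval hunr' hinf' hr' hrκ' hval' hΩK hΩK' hΩp hΩp' hv hw hc hQ'

end BDP

end Summit.BirchSwinnertonDyer.Rank1Residual.X11b

end
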